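import Mathlib.Data.List.Sort
import Mathlib.Data.List.Range
import Mathlib.Data.List.Nodup
import Mathlib.Data.List.GetD
import Mathlib.Tactic.Linarith
import HarnessLib

/-!
# Consistency of a stack transcript from a sorted certificate

Literature / complexity toolkit (serves the quasi-linear succinct Cook–Levin reduction behind
Williams' Fact 3.1, `SuccinctSkeletonReductions.lean`, leaf `Williams2014_fact_3_1_skeleton`).
A *transcript* of one pushdown stack is a sequence of events `ev s`, `s < N` — `push b`,
`popSome b` ("the pop returned `b`"), `popNone` ("the pop found the stack empty"), `nop` —
in which the popped symbols are CLAIMS. The transcript is *consistent* (`Consistent`) if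
replaying it from the empty stack confirms every claim. Consistency is a non-local property
(a pop is answered by a push arbitrarily far in the past); this file reduces it to LOCAL checks
on a re-ordering of the events, the device by which memory consistency is verified in
quasi-linear size (Gurevich–Shelah 1989; Robson 1991; Fortnow–Lipton–van Melkebeek–Viglas 2005,
§3.1: sort the accesses by (address, time) and compare neighbours — for a stack the address is
the stack height):

* `HeightsOK ev h N` — `h s` is the stack height before event `s` (local rules: `+1` on a push,
  `-1` on a `popSome`, which needs height `≥ 1`, `= 0` on a `popNone`);
* `level ev h s` — the height of the cell an event touches (`h (s+1)` for a push, `h s` for a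
  `popSome`, `0` otherwise) and the strict *key order* `KeyLt` = lexicographic (level, time);
* `Cert ev h N π` — a *sorted certificate*: `π` enumerates `[0, N)` in increasing key order,
  every `popSome b` is immediately preceded in that order by a `push b` of the same level, and
  the first event in key order is not a `popSome`;
* **`consistent_of_cert`** (soundness) — heights obeying the local rules and a sorted
  certificate imply consistency (and `h` IS the height of the replayed stack);
* **`exists_cert_of_consistent`** (completeness) — a consistent transcript obeys the local
  height rules for the true heights and admits a sorted certificate (sort by key; the matching
  push of a pop is the latest event of its level before it, `W`-invariant `wInv`).

Both directions rest on one combinatorial fact about stacks: the cell at height `g` holds the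
symbol of the latest push of level `g`, and no other event of level `g` happened since.

## References

* L. Fortnow, R. Lipton, D. van Melkebeek, A. Viglas, *Time-space lower bounds for
  satisfiability*, J. ACM 52 (2005) 835–865, §3.1 [FortnowEtAl2005].
* Y. Gurevich, S. Shelah, *Nearly linear time*, LNCS 363 (1989) 108–118 [GurevichShelah1989].
* J. M. Robson, *An `O(T log T)` reduction from RAM computations to satisfiability*, Theoret.
  Comput. Sci. 82 (1991) 141–149.
-/

namespace Literature.Computability.Complexity

namespace StackEvents

/-! ### Events, replay, consistency -/

/-- An event of one stack at one time step: no access, a push of `b`, a pop that found the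
stack empty, or a pop that (claims to have) returned `b`. [cite: FortnowEtAl2005, §3.1] -/
inductive Ev : Type
  | nop : Ev
  | push (b : Bool) : Ev
  | popNone : Ev
  | popSome (b : Bool) : Ev
  deriving DecidableEq, Inhabited

/-- The effect of an event on the stack contents when its claim is taken on trust (a `popSome`
removes the top whatever it is, a `popNone` leaves the stack alone). [folklore] -/
def upd : Ev → List Bool → List Bool
  | .nop, S => S
  | .push b, S => b :: S
  | .popNone, S => S
  | .popSome _, S => S.tail

/-- The replayed stack before event `s`, starting from the empty stack. [folklore] -/
def st (ev : ℕ → Ev) : ℕ → List Bool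
  | 0 => []
  | s + 1 => upd (ev s) (st ev s)

/-- **Consistency** of the first `N` events: replaying from the empty stack, every `popNone`
finds the stack empty and every `popSome b` finds `b` on top. [cite: FortnowEtAl2005, §3.1] -/
def Consistent (ev : ℕ → Ev) (N : ℕ) : Prop :=
  ∀ s < N, (ev s = .popNone → st ev s = []) ∧ ∀ b, ev s = .popSome b → (st ev s).head? = some b

/-- **Local height rules** for a claimed height sequence `h` (`h s` = height before event
`s`): start at `0`; a push adds one; a `popSome` removes one and needs a nonempty stack; a
`popNone` needs and keeps height `0`; `nop` keeps the height. [cite: FortnowEtAl2005, §3.1] -/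
def HeightsOK (ev : ℕ → Ev) (h : ℕ → ℕ) (N : ℕ) : Prop :=
  h 0 = 0 ∧ ∀ s < N, match ev s with
    | .nop => h (s + 1) = h s
    | .push _ => h (s + 1) = h s + 1
    | .popNone => h s = 0 ∧ h (s + 1) = 0
    | .popSome _ => h (s + 1) + 1 = h s

/-- The *level* of an event: the height of the stack cell it writes (push: the new height) or
reads (`popSome`: the old height); `0` for events touching no cell. [cite: FortnowEtAl2005, §3.1] -/
def level (ev : ℕ → Ev) (h : ℕ → ℕ) (s : ℕ) : ℕ :=
  match ev s with
  | .push _ => h (s + 1)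
  | .popSome _ => h s
  | _ => 0

/-- The strict key order on times: lexicographic by (level, time). [cite: FortnowEtAl2005, §3.1] -/
def KeyLt (ev : ℕ → Ev) (h : ℕ → ℕ) (a b : ℕ) : Prop :=
  level ev h a < level ev h b ∨ (level ev h a = level ev h b ∧ a < b)

/-- **Sorted certificate** for the first `N` events with heights `h`: `π` lists `[0, N)` in
strictly increasing key order (`sorted`, with `lt`/`surj` making it a bijection), every
`popSome b` is immediately preceded in key order by a `push b` of the same level (`adj`), and
the key-smallest event is not a `popSome` (`first`). [cite: FortnowEtAl2005, §3.1] -/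
structure Cert (ev : ℕ → Ev) (h : ℕ → ℕ) (N : ℕ) (π : ℕ → ℕ) : Prop where
  /-- `π` maps `[0, N)` into `[0, N)`. -/
  lt : ∀ p < N, π p < N
  /-- `π` is onto `[0, N)`. -/
  surj : ∀ s < N, ∃ p < N, π p = s
  /-- Consecutive entries increase strictly in key order. -/
  sorted : ∀ p, p + 1 < N → KeyLt ev h (π p) (π (p + 1))
  /-- A `popSome b` is preceded by a `push b` of the same level. -/
  adj : ∀ p, p + 1 < N → ∀ b, ev (π (p + 1)) = .popSome b →
    ev (π p) = .push b ∧ level ev h (π p) = level ev h (π (p + 1))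
  /-- The first entry is not a `popSome`. -/
  first : 0 < N → ∀ b, ev (π 0) ≠ .popSome b

/-! ### The key order -/

section Key

variable {ev : ℕ → Ev} {h : ℕ → ℕ}

/-- The key order is irreflexive. [folklore] -/
theorem KeyLt.irrefl (a : ℕ) : ¬ KeyLt ev h a a := by
  rintro (h1 | ⟨-, h2⟩) <;> omega

/-- The key order is transitive. [folklore] -/
theorem KeyLt.trans {a b c : ℕ} (h₁ : KeyLt ev h a b) (h₂ : KeyLt ev h b c) : KeyLt ev h a c := by
  rcases h₁ with h₁ | ⟨e₁, t₁⟩ <;> rcases h₂ with h₂ | ⟨e₂, t₂⟩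
  · exact Or.inl (h₁.trans h₂)
  · exact Or.inl (e₂ ▸ h₁)
  · exact Or.inl (e₁ ▸ h₂)
  · exact Or.inr ⟨e₁.trans e₂, t₁.trans t₂⟩

/-- The key order is asymmetric. [folklore] -/
theorem KeyLt.asymm {a b : ℕ} (h₁ : KeyLt ev h a b) : ¬ KeyLt ev h b a :=
  fun h₂ => KeyLt.irrefl a (h₁.trans h₂)

/-- Distinct times are comparable in key order. [folklore] -/
theorem KeyLt.total {a b : ℕ} (hab : a ≠ b) : KeyLt ev h a b ∨ KeyLt ev h b a := by
  unfold KeyLt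
  rcases lt_trichotomy (level ev h a) (level ev h b) with h1 | h1 | h1
  · exact Or.inl (Or.inl h1)
  · rcases lt_or_gt_of_ne hab with h2 | h2
    · exact Or.inl (Or.inr ⟨h1, h2⟩)
    · exact Or.inr (Or.inr ⟨h1.symm, h2⟩)
  · exact Or.inr (Or.inl h1)

/-- The key order refines the order of levels. [folklore] -/
theorem KeyLt.level_le {a b : ℕ} (h₁ : KeyLt ev h a b) : level ev h a ≤ level ev h b := by
  rcases h₁ with h₁ | ⟨e, -⟩
  · exact h₁.le
  · exact e.le

/-- With equal levels the key order is the time order. [folklore] -/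
theorem KeyLt.lt_of_level_eq {a b : ℕ} (h₁ : KeyLt ev h a b) (he : level ev h a = level ev h b) :
    a < b := by
  rcases h₁ with h₁ | ⟨-, t⟩
  · omega
  · exact t

end Key

/-! ### Consequences of a certificate -/

namespace Cert

variable {ev : ℕ → Ev} {h : ℕ → ℕ} {N : ℕ} {π : ℕ → ℕ}

/-- Entries of a certificate increase in key order (not only consecutive ones). [folklore] -/
theorem keyLt_of_lt (c : Cert ev h N π) {p q : ℕ} (hpq : p < q) (hq : q < N) :
    KeyLt ev h (π p) (π q) := by
  induction q with
  | zero => exact absurd hpq (Nat.not_lt_zero p)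
  | succ q ih =>
    rcases Nat.lt_succ_iff_lt_or_eq.1 hpq with hlt | rfl
    · exact (ih hlt (Nat.lt_of_succ_lt hq)).trans (c.sorted q hq)
    · exact c.sorted p hq

/-- A certificate is injective on `[0, N)`. [folklore] -/
theorem injOn (c : Cert ev h N π) {p q : ℕ} (hp : p < N) (hq : q < N) (hpq : π p = π q) :
    p = q := by
  by_contra hne
  rcases lt_or_gt_of_ne hne with hlt | hlt
  · have := c.keyLt_of_lt hlt hq; rw [hpq] at this; exact KeyLt.irrefl _ this
  · have := c.keyLt_of_lt hlt hp; rw [hpq] at this; exact KeyLt.irrefl _ this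

/-- Nothing lies strictly between two consecutive entries of a certificate. [folklore] -/
theorem not_between (c : Cert ev h N π) {p t : ℕ} (hp : p + 1 < N) (ht : t < N)
    (h₁ : KeyLt ev h (π p) t) (h₂ : KeyLt ev h t (π (p + 1))) : False := by
  obtain ⟨j, hj, rfl⟩ := c.surj t ht
  rcases lt_trichotomy j p with hjp | rfl | hjp
  · exact h₁.asymm (c.keyLt_of_lt hjp (Nat.lt_of_succ_lt hp))
  · exact KeyLt.irrefl _ h₁
  · rcases Nat.eq_or_lt_of_le (Nat.succ_le_of_lt hjp) with h3 | h3
    · rw [← h3] at h₂; exact KeyLt.irrefl _ h₂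
    · exact h₂.asymm (c.keyLt_of_lt h3 hj)

end Cert

/-! ### Soundness: a certificate makes the transcript consistent -/

section Soundness

variable {ev : ℕ → Ev} {h : ℕ → ℕ} {N : ℕ}

/-- Length bookkeeping of the replay. [folklore] -/
theorem length_st_succ (ev : ℕ → Ev) (s : ℕ) :
    (st ev (s + 1)).length = match ev s with
      | .nop => (st ev s).length
      | .push _ => (st ev s).length + 1
      | .popNone => (st ev s).length
      | .popSome _ => (st ev s).length - 1 := by
  show (upd (ev s) (st ev s)).length = _
  cases ev s <;> simp [upd]

/-- The soundness invariant: the replayed stack has the claimed height, and its cell at depth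
`i` holds the symbol of the latest push `t` with `h (t+1) + i = h s`. [folklore] -/
theorem sound_inv (hH : HeightsOK ev h N) : ∀ s ≤ N,
    (st ev s).length = h s ∧ ∀ (i : ℕ) (a : Bool), (st ev s)[i]? = some a →
      ∃ t < s, ev t = .push a ∧ h (t + 1) + i = h s ∧
        ∀ u, t < u → u < s → ∀ c, ev u = .push c → h (u + 1) + i ≠ h s := by
  intro s
  induction s with
  | zero => intro _; exact ⟨by simp [st, hH.1], fun i a hi => by simp [st] at hi⟩
  | succ s ih =>
    intro hs
    have hsN : s < N := Nat.lt_of_succ_le hs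
    obtain ⟨hlen, hinv⟩ := ih hsN.le
    have hrule := hH.2 s hsN
    revert hrule
    cases hev : ev s with
    | nop =>
      intro hrule
      have hst : st ev (s + 1) = st ev s := by show upd (ev s) _ = _; rw [hev]; rfl
      rw [hst, hrule]
      refine ⟨hlen, fun i a hi => ?_⟩
      obtain ⟨t, ht, hpush, hlev, hlat⟩ := hinv i a hi
      refine ⟨t, Nat.lt_succ_of_lt ht, hpush, hlev, fun u htu hus c hc => ?_⟩
      rcases Nat.lt_succ_iff_lt_or_eq.1 hus with hus | rfl
      · exact hlat u htu hus c hc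
      · rw [hev] at hc; cases hc
    | push b =>
      intro hrule
      have hst : st ev (s + 1) = b :: st ev s := by show upd (ev s) _ = _; rw [hev]; rfl
      rw [hst, hrule]
      refine ⟨by simp [hlen], fun i a hi => ?_⟩
      cases i with
      | zero =>
        simp only [List.getElem?_cons_zero, Option.some.injEq] at hi
        subst hi
        refine ⟨s, Nat.lt_succ_self s, hev, by rw [hrule], fun u hsu hus _ _ => ?_⟩
        omega
      | succ i =>
        simp only [List.getElem?_cons_succ] at hi
        obtain ⟨t, ht, hpush, hlev, hlat⟩ := hinv i a hi
        refine ⟨t, Nat.lt_succ_of_lt ht, hpush, by omega, fun u htu hus c hc => ?_⟩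
        rcases Nat.lt_succ_iff_lt_or_eq.1 hus with hus | rfl
        · have := hlat u htu hus c hc; omega
        · rw [hrule]; omega
    | popNone =>
      rintro ⟨h0, h1⟩
      have hst : st ev (s + 1) = st ev s := by show upd (ev s) _ = _; rw [hev]; rfl
      have hnil : st ev s = [] := List.eq_nil_of_length_eq_zero (by rw [hlen, h0])
      rw [hst, hnil, h1]
      exact ⟨rfl, fun i a hi => by simp at hi⟩
    | popSome b =>
      intro hrule
      have hst : st ev (s + 1) = (st ev s).tail := by show upd (ev s) _ = _; rw [hev]; rfl
      obtain ⟨a₀, rest, hcons⟩ : ∃ a₀ rest, st ev s = a₀ :: rest := by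
        cases hq : st ev s with
        | nil => rw [hq] at hlen; simp at hlen; omega
        | cons a₀ rest => exact ⟨a₀, rest, rfl⟩
      rw [hst, hcons, List.tail_cons]
      rw [hcons] at hlen hinv
      simp only [List.length_cons] at hlen
      refine ⟨by omega, fun i a hi => ?_⟩
      obtain ⟨t, ht, hpush, hlev, hlat⟩ := hinv (i + 1) a (by simpa using hi)
      refine ⟨t, Nat.lt_succ_of_lt ht, hpush, by omega, fun u htu hus c hc => ?_⟩
      rcases Nat.lt_succ_iff_lt_or_eq.1 hus with hus | rfl
      · have := hlat u htu hus c hc; omega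
      · rw [hev] at hc; cases hc

/-- **Soundness of sorted certificates**: if the claimed heights obey the local rules and a
sorted certificate exists, the transcript is consistent (and the claimed heights are the true
ones). The top of the stack before a `popSome` at level `g` is the symbol of the latest push of
level `g`; by the certificate the latest EVENT of level `g` is a `push b` (nothing lies between
neighbours in key order), so the two coincide. [cite: FortnowEtAl2005, §3.1] -/
theorem consistent_of_cert {π : ℕ → ℕ} (hH : HeightsOK ev h N) (c : Cert ev h N π) :
    Consistent ev N ∧ ∀ s ≤ N, (st ev s).length = h s := by
  refine ⟨fun s hs => ⟨fun hev => ?_, fun b hev => ?_⟩, fun s hs => (sound_inv hH s hs).1⟩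
  · -- popNone: height 0
    have hrule := hH.2 s hs
    rw [hev] at hrule
    exact List.eq_nil_of_length_eq_zero (by rw [(sound_inv hH s hs.le).1, hrule.1])
  · -- popSome: the latest push of level `h s` carries the top symbol
    obtain ⟨hlen, hinv⟩ := sound_inv hH s hs.le
    have hrule := hH.2 s hs
    rw [hev] at hrule
    obtain ⟨a₀, rest, hcons⟩ : ∃ a₀ rest, st ev s = a₀ :: rest := by
      cases hq : st ev s with
      | nil => rw [hq] at hlen; simp at hlen; omega
      | cons a₀ rest => exact ⟨a₀, rest, rfl⟩
    obtain ⟨t, hts, hpush, hlev, hlat⟩ := hinv 0 a₀ (by rw [hcons]; rfl)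
    rw [Nat.add_zero] at hlev
    -- the certificate's predecessor of `s`
    obtain ⟨q, hq, hqs⟩ := c.surj s hs
    obtain ⟨p, rfl⟩ : ∃ p, q = p + 1 := by
      cases q with
      | zero => exact absurd hev (by rw [← hqs]; exact c.first hq b)
      | succ p => exact ⟨p, rfl⟩
    obtain ⟨hr, hlevr⟩ := c.adj p hq b (by rw [hqs]; exact hev)
    have hlevs : level ev h s = h s := by simp only [level, hev]
    have hlevr' : h (π p + 1) = h s := by
      have : level ev h (π p) = h (π p + 1) := by simp only [level, hr]
      rw [← this, hlevr, hqs, hlevs]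
    have hrs : π p < s := by
      have := c.sorted p hq; rw [hqs] at this
      exact this.lt_of_level_eq (by rw [hlevr, hqs])
    -- compare `t` (latest push of that level) with `π p`
    rcases lt_trichotomy t (π p) with htr | htr | htr
    · exact absurd hlevr' (hlat (π p) htr hrs b hr)
    · subst htr
      rw [hr] at hpush
      cases hpush
      rw [hcons]; rfl
    · have hlevt : level ev h t = h s := by simp only [level, hpush]; exact hlev
      have h1 : KeyLt ev h (π p) t := Or.inr ⟨by rw [hlevr, hqs, hlevs, hlevt], htr⟩
      have h2 : KeyLt ev h t (π (p + 1)) := Or.inr ⟨by rw [hqs, hlevs, hlevt], by rw [hqs]; exact hts⟩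
      exact (c.not_between hq (hts.trans hs) h1 h2).elim

end Soundness

/-! ### Completeness: a consistent transcript has a certificate -/

section Completeness

variable {ev : ℕ → Ev} {N : ℕ}

/-- The true height sequence of the replay. [folklore] -/
def ht (ev : ℕ → Ev) (s : ℕ) : ℕ := (st ev s).length

/-- A consistent transcript obeys the local height rules for its true heights. [folklore] -/
theorem heightsOK_of_consistent (hC : Consistent ev N) : HeightsOK ev (ht ev) N := by
  refine ⟨rfl, fun s hs => ?_⟩
  obtain ⟨hnone, hsome⟩ := hC s hs
  show match ev s with
    | .nop => (st ev (s+1)).length = (st ev s).length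
    | .push _ => (st ev (s+1)).length = (st ev s).length + 1
    | .popNone => (st ev s).length = 0 ∧ (st ev (s+1)).length = 0
    | .popSome _ => (st ev (s+1)).length + 1 = (st ev s).length
  have hst : st ev (s + 1) = upd (ev s) (st ev s) := rfl
  revert hnone hsome hst
  cases ev s with
  | nop => intro _ _ hst; simp [hst, upd]
  | push b => intro _ _ hst; simp [hst, upd]
  | popNone => intro hnone _ hst; simp [hst, upd, hnone rfl]
  | popSome b =>
    intro _ hsome hst
    have hne : st ev s ≠ [] := by
      intro hnil; have := hsome b rfl; rw [hnil] at this; simp at this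
    obtain ⟨a, rest, hcons⟩ := List.exists_cons_of_ne_nil hne
    simp [hst, upd, hcons]

/-- The push times of the cells of the replayed stack, top first. [folklore] -/
def W (ev : ℕ → Ev) : ℕ → List ℕ
  | 0 => []
  | s + 1 => match ev s with
    | .push _ => s :: W ev s
    | .popSome _ => (W ev s).tail
    | _ => W ev s

/-- The symbol pushed at time `t` (`false` if `ev t` is not a push). [folklore] -/
def symOf (ev : ℕ → Ev) (t : ℕ) : Bool :=
  match ev t with
  | .push b => b
  | _ => false

/-- The replayed stack is the list of symbols of the recorded push times. [folklore] -/
theorem st_eq_map_W (ev : ℕ → Ev) : ∀ s, st ev s = (W ev s).map (symOf ev)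
  | 0 => rfl
  | s + 1 => by
    have ih := st_eq_map_W ev s
    show upd (ev s) (st ev s) = (match ev s with
      | .push _ => s :: W ev s
      | .popSome _ => (W ev s).tail
      | _ => W ev s).map (symOf ev)
    cases hev : ev s with
    | nop => simpa [upd] using ih
    | push b => simp [upd, ih, symOf, hev]
    | popNone => simpa [upd] using ih
    | popSome b => simp [upd, ih, List.map_tail]

/-- `ht ev s = |W ev s|`. [folklore] -/
theorem ht_eq_length_W (ev : ℕ → Ev) (s : ℕ) : ht ev s = (W ev s).length := by
  simp [ht, st_eq_map_W]

/-- **The stack invariant** of a consistent transcript: the cell recorded at depth `i` before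
time `s` was pushed at a time `t < s` of level `ht (t+1) = ht s - i`, and NO event of that
level happened strictly between `t` and `s`. [folklore] -/
theorem wInv (hC : Consistent ev N) : ∀ s ≤ N, ∀ (i t : ℕ), (W ev s)[i]? = some t →
    t < s ∧ (∃ b, ev t = .push b) ∧ ht ev (t + 1) + i = ht ev s ∧
      ∀ u, t < u → u < s → level ev (ht ev) u + i ≠ ht ev s := by
  intro s
  induction s with
  | zero => intro _ i t hi; simp [W] at hi
  | succ s ih =>
    intro hs i t hi
    have hsN : s < N := Nat.lt_of_succ_le hs
    have ih' := ih hsN.le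
    have hrule := (heightsOK_of_consistent hC).2 s hsN
    have hW : W ev (s + 1) = (match ev s with
      | .push _ => s :: W ev s
      | .popSome _ => (W ev s).tail
      | _ => W ev s) := rfl
    have hlenW := ht_eq_length_W ev s
    revert hrule hW
    cases hev : ev s with
    | nop =>
      intro hrule hW
      rw [hW] at hi
      obtain ⟨ht', hb, hl, hlat⟩ := ih' i t hi
      have hlevs : level ev (ht ev) s = 0 := by simp [level, hev]
      have hi_lt : i < (W ev s).length := (List.getElem?_eq_some_iff.1 hi).1
      refine ⟨Nat.lt_succ_of_lt ht', hb, by rw [hrule]; exact hl, fun u htu hus => ?_⟩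
      rcases Nat.lt_succ_iff_lt_or_eq.1 hus with hus | rfl
      · rw [hrule]; exact hlat u htu hus
      · rw [hrule, hlevs, hlenW]; omega
    | push b =>
      intro hrule hW
      rw [hW] at hi
      cases i with
      | zero =>
        simp only [List.getElem?_cons_zero, Option.some.injEq] at hi
        subst hi
        refine ⟨Nat.lt_succ_self _, ⟨b, hev⟩, rfl, fun u h1 h2 => ?_⟩
        omega
      | succ i =>
        simp only [List.getElem?_cons_succ] at hi
        obtain ⟨ht', hb, hl, hlat⟩ := ih' i t hi
        have hlevs : level ev (ht ev) s = ht ev (s + 1) := by simp [level, hev]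
        refine ⟨Nat.lt_succ_of_lt ht', hb, by rw [hrule]; omega, fun u htu hus => ?_⟩
        rcases Nat.lt_succ_iff_lt_or_eq.1 hus with hus | rfl
        · have := hlat u htu hus; rw [hrule]; omega
        · rw [hlevs]; omega
    | popNone =>
      intro hrule hW
      rw [hW] at hi
      have h0 : (W ev s).length = 0 := by rw [← hlenW]; exact hrule.1
      rw [List.eq_nil_of_length_eq_zero h0] at hi
      simp at hi
    | popSome b =>
      intro hrule hW
      rw [hW] at hi
      obtain ⟨t₀, rest, hcons⟩ : ∃ t₀ rest, W ev s = t₀ :: rest := by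
        cases hq : W ev s with
        | nil => rw [hq] at hlenW; simp at hlenW; omega
        | cons t₀ rest => exact ⟨t₀, rest, rfl⟩
      rw [hcons, List.tail_cons] at hi
      obtain ⟨ht', hb, hl, hlat⟩ := ih' (i + 1) t (by rw [hcons]; simpa using hi)
      have hlevs : level ev (ht ev) s = ht ev s := by simp [level, hev]
      refine ⟨Nat.lt_succ_of_lt ht', hb, by omega, fun u htu hus => ?_⟩
      rcases Nat.lt_succ_iff_lt_or_eq.1 hus with hus | rfl
      · have := hlat u htu hus; omega
      · rw [hlevs]; omega

/-- For a `popSome b` at time `s < N` of a consistent transcript: the latest event of level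
`ht s` before `s` is a push of `b` (namely the push of the current top cell). [folklore] -/
theorem latest_push_of_popSome (hC : Consistent ev N) {s : ℕ} (hs : s < N) {b : Bool}
    (hev : ev s = .popSome b) :
    ∃ t < s, ev t = .push b ∧ level ev (ht ev) t = level ev (ht ev) s ∧
      ∀ u, t < u → u < s → level ev (ht ev) u ≠ level ev (ht ev) s := by
  have hsome := (hC s hs).2 b hev
  have hst := st_eq_map_W ev s
  obtain ⟨t₀, rest, hcons⟩ : ∃ t₀ rest, W ev s = t₀ :: rest := by
    cases hq : W ev s with
    | nil => rw [hq] at hst; rw [hst] at hsome; simp at hsome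
    | cons t₀ rest => exact ⟨t₀, rest, rfl⟩
  obtain ⟨ht', ⟨b', hb'⟩, hl, hlat⟩ := wInv hC s hs.le 0 t₀ (by rw [hcons]; rfl)
  have hbb : b' = b := by
    rw [hcons] at hst
    rw [hst] at hsome
    simp only [List.map_cons, List.head?_cons, Option.some.injEq, symOf, hb'] at hsome
    exact hsome
  subst hbb
  have hlevs : level ev (ht ev) s = ht ev s := by simp [level, hev]
  have hlevt : level ev (ht ev) t₀ = ht ev (t₀ + 1) := by simp [level, hb']
  refine ⟨t₀, ht', hb', by rw [hlevt, hlevs]; simpa using hl, fun u h1 h2 => ?_⟩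
  rw [hlevs]; simpa using hlat u h1 h2

/-- The non-strict key order, used for sorting. [folklore] -/
def KeyLe (ev : ℕ → Ev) (h : ℕ → ℕ) (a b : ℕ) : Prop := KeyLt ev h a b ∨ a = b

open Classical in
/-- **Completeness of sorted certificates**: a consistent transcript, with its true heights,
has a sorted certificate — list `[0, N)` in key order (insertion sort); the neighbour
conditions hold by `latest_push_of_popSome`. [cite: FortnowEtAl2005, §3.1] -/
theorem exists_cert_of_consistent (hC : Consistent ev N) :
    HeightsOK ev (ht ev) N ∧ ∃ π : ℕ → ℕ, Cert ev (ht ev) N π := by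
  refine ⟨heightsOK_of_consistent hC, ?_⟩
  let r : ℕ → ℕ → Prop := KeyLe ev (ht ev)
  haveI : Std.Total r := ⟨fun a b => by
    by_cases hab : a = b
    · exact Or.inl (Or.inr hab)
    · rcases KeyLt.total (ev := ev) (h := ht ev) hab with h1 | h1
      · exact Or.inl (Or.inl h1)
      · exact Or.inr (Or.inl h1)⟩
  haveI : IsTrans ℕ r := ⟨fun a b c h₁ h₂ => by
    rcases h₁ with h₁ | rfl
    · rcases h₂ with h₂ | rfl
      · exact Or.inl (h₁.trans h₂)
      · exact Or.inl h₁
    · exact h₂⟩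
  let l : List ℕ := (List.range N).insertionSort r
  have hperm : l.Perm (List.range N) := List.perm_insertionSort r _
  have hlen : l.length = N := by rw [hperm.length_eq, List.length_range]
  have hnodup : l.Nodup := hperm.nodup_iff.2 (List.nodup_range)
  have hsortd : l.Pairwise r := List.pairwise_insertionSort r _
  have hmem : ∀ {s}, s ∈ l ↔ s < N := fun {s} => by rw [hperm.mem_iff, List.mem_range]
  let π : ℕ → ℕ := fun p => if hp : p < l.length then l[p] else 0
  have hπ : ∀ {p} (hp : p < N), π p = l[p]'(by rw [hlen]; exact hp) := fun {p} hp => by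
    simp only [π, dif_pos (show p < l.length by rw [hlen]; exact hp)]
  -- strict key order between positions
  have hkey : ∀ {p q}, p < q → (hq : q < N) → KeyLt ev (ht ev) (π p) (π q) := by
    intro p q hpq hq
    have hp : p < N := hpq.trans hq
    rw [hπ hp, hπ hq]
    have h1 : r (l[p]'(by rw [hlen]; exact hp)) (l[q]'(by rw [hlen]; exact hq)) :=
      List.pairwise_iff_getElem.1 hsortd p q _ _ hpq
    rcases h1 with h1 | h1
    · exact h1
    · exact absurd (hnodup.getElem_inj_iff.1 h1) (Nat.ne_of_lt hpq)
  -- positions of given times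
  have hpos : ∀ {s}, s < N → ∃ j < N, π j = s := by
    intro s hs
    obtain ⟨j, hj, hjs⟩ := List.getElem_of_mem (hmem.2 hs)
    refine ⟨j, by rw [← hlen]; exact hj, ?_⟩
    rw [hπ (by rw [← hlen]; exact hj)]; exact hjs
  -- the predecessor of a popSome is its latest same-level event, a push of the same symbol
  have hpred : ∀ {q} (hq : q < N) (b : Bool), ev (π q) = .popSome b →
      ∃ p, q = p + 1 ∧ ev (π p) = .push b ∧ level ev (ht ev) (π p) = level ev (ht ev) (π q) := by
    intro q hq b hev
    have hs : π q < N := by rw [hπ hq]; exact hmem.1 (List.getElem_mem _)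
    obtain ⟨t, hts, hpush, hlev, hlat⟩ := latest_push_of_popSome hC hs hev
    obtain ⟨j, hj, hjt⟩ := hpos (hts.trans hs)
    have htq : KeyLt ev (ht ev) t (π q) := Or.inr ⟨hlev, hts⟩
    -- `j < q`
    have hjq : j < q := by
      by_contra hge
      rcases Nat.eq_or_lt_of_le (Nat.le_of_not_lt hge) with hqj | hqj
      · subst hqj; rw [hjt] at htq; exact KeyLt.irrefl _ htq
      · have := hkey hqj hj; rw [hjt] at this; exact htq.asymm this
    obtain ⟨p, rfl⟩ : ∃ p, q = p + 1 := ⟨q - 1, by omega⟩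
    refine ⟨p, rfl, ?_⟩
    -- `j = p`: otherwise `π p` is a same-level event strictly between `t` and `π q`
    rcases Nat.lt_succ_iff_lt_or_eq.1 hjq with hjp | hjp
    · exfalso
      have h1 : KeyLt ev (ht ev) t (π p) := by have := hkey hjp (Nat.lt_of_succ_lt hq); rwa [hjt] at this
      have h2 : KeyLt ev (ht ev) (π p) (π (p + 1)) := hkey (Nat.lt_succ_self p) hq
      have hl1 := h1.level_le
      have hl2 := h2.level_le
      have hlevp : level ev (ht ev) (π p) = level ev (ht ev) (π (p + 1)) := by omega
      have htp : t < π p := h1.lt_of_level_eq (by omega)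
      have hps : π p < π (p + 1) := h2.lt_of_level_eq hlevp
      exact hlat (π p) htp hps hlevp
    · subst hjp; rw [hjt]; exact ⟨hpush, hlev⟩
  refine ⟨π, ⟨fun p hp => ?_, fun s hs => hpos hs, fun p hp => hkey (Nat.lt_succ_self p) hp,
    fun p hp b hev => ?_, fun hN b hev => ?_⟩⟩
  · rw [hπ hp]; exact hmem.1 (List.getElem_mem _)
  · obtain ⟨p', hp', hpush, hlev⟩ := hpred hp b hev
    have : p' = p := by omega
    subst this
    exact ⟨hpush, hlev⟩
  · obtain ⟨p', hp', -, -⟩ := hpred hN b hev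
    omega

end Completeness

end StackEvents

end Literature.Computability.Complexity
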